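import Summits.CriticalPhenomena.PercolationContinuityZ3.Theorems.PercNearOneGluingNoHeavyPcintMemUniformEight
import Summits.CriticalPhenomena.PercolationContinuityZ3.Theorems.PercNearOneGluingNoHeavyPcintClosingOctagonsExactAll
import Summits.CriticalPhenomena.PercolationContinuityZ3.Theorems.PercNearOneGluingNoHeavyPcintClosingOctagonsZ4Exact
import Summits.CriticalPhenomena.PercolationContinuityZ3.Theorems.PercNearOneGluingNoHeavyPcintMemUniformSix
import Summits.CriticalPhenomena.PercolationContinuityZ3.Theorems.PercNearOneGluingNoHeavyPcintClosingHexagonsExact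
import Summits.CriticalPhenomena.PercolationContinuityZ3.Theorems.PercNearOneGluingNoHeavyPcintMemoryFourBracketsSeven
import Summits.CriticalPhenomena.PercolationContinuityZ3.Theorems.PercNearOneGluingNoHeavyPcintLoopExclusionTable
import Summits.CriticalPhenomena.PercolationContinuityZ3.Theorems.PercNearOneGluingNoHeavyPcintLoopExclusionRungSixDimension
import HarnessLib

/-!
# CriticalPhenomena/PercolationContinuityZ3 — Theorems/PercNearOneGluingNoHeavyPcintRungEightBrackets.lean: `R_6(d)` and `R_8(d)` between ratios of INTEGER POLYNOMIALS in `d` (every `d ≥ 5`)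

Lane prim-pcint, STRUCTURE rule (prim-pcint-2 GEN 18; part 1 of the third-rung dimension law, part 2 = …LoopExclusionRungEightDimension).
`loopCompat_le_of_brackets` / `loopCompat_ge_of_brackets`: brackets of the two growth constants and the exact polygon count give
`R_τ ≤ (U/L' − 1)·U^τ/C` and `R_τ ≥ (1 − U'/L)·L^τ/C` (any rung); `rup_identity` / `rlo_identity` write these as single fractions;
with the uniform certificates (…MemUniformSix, …MemUniformEight), the seven-term `μ_4` brackets and the exact counts
(…ClosingHexagonsExact, …ClosingOctagonsExactAll) all brackets are `peval` of integer coefficient lists (…PcintPolyCert), so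
**`loopCompat_eight_le_peval` / `ge_peval`** (`NL8/DL8 ≤ R_8(d) ≤ NU8/DE8`, `d ≥ 5`) and **`loopCompat_six_ge_peval`** (`NL6/DL6 ≤ R_6(d)`,
`d ≥ 4`) with computable numerators/denominators (degrees ≤ 76); their positivity by `decide` (`DE8_pos`, `DL8_pos`, `DL6_pos`).

HONEST FRAMING: bracket arithmetic.  No `sorry`; standard axioms.  Generated by numerics/gen_u8law.py.  Written by prim-pcint-2 gen 18, 2026-08-26.
-/

noncomputable section

open Filter Topology
open Literature.Probability.LatticeModels Literature.Probability.Percolation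
open Summit.CriticalPhenomena.PercolationContinuityZ3.Theorems.Pcint
open Summit.CriticalPhenomena.PercolationContinuityZ3.Theorems.Pcint.PolyCert

namespace Summit.CriticalPhenomena.PercolationContinuityZ3.Theorems.Pcint.PolyCert

/-! ### Small additions to the polynomial toolkit -/

/-- Difference of coefficient lists. [folklore] -/
def psub (p q : List ℤ) : List ℤ := padd p (psmul (-1) q)

/-- `peval` of a difference. [folklore] -/
theorem peval_psub (p q : List ℤ) (x : ℝ) : peval (psub p q) x = peval p x - peval q x := by
  rw [psub, peval_padd, peval_psmul]; push_cast; ring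

/-- Strict half-line comparison from a `posHead` certificate of the difference. [folklore] -/
theorem peval_lt_of_shift {p q : List ℤ} {c : ℤ} (h : posHead (pshift (psub q p) c) = true) {x : ℝ} (hx : (c : ℝ) ≤ x) :
    peval p x < peval q x := by
  have := peval_pos_of_shift h hx
  rw [peval_psub] at this
  linarith

end Summit.CriticalPhenomena.PercolationContinuityZ3.Theorems.Pcint.PolyCert

namespace Summit.CriticalPhenomena.PercolationContinuityZ3.Theorems.Pcint.MemoryTail

variable {d : ℕ}

/-! ### Compatibility-factor bounds from brackets (any rung) -/

/-- **Upper bound of `R_τ` from brackets**: `μ_{τ−2} ≤ U`, `0 < L' ≤ μ_τ`, `2τ p_τ = C > 0` give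
`R_τ(d) ≤ (U/L' − 1)·U^τ/C` (`log q ≤ q − 1`, `μ_{τ−2}^τ ≤ U^τ`). [folklore] -/
theorem loopCompat_le_of_brackets [NeZero d] {τ : ℕ} {U Lc C : ℝ} (hU : memGrowth d (τ - 2) ≤ U)
    (hLc : Lc ≤ memGrowth d τ) (hLcpos : 0 < Lc) (hC : (closingCount d τ : ℝ) = C) (hCpos : 0 < C) :
    loopCompat d τ ≤ (U / Lc - 1) * U ^ τ / C := by
  have hμp : 0 < memGrowth d (τ - 2) := memGrowth_pos _
  have hμc : 0 < memGrowth d τ := memGrowth_pos _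
  have hΔ0 : 0 ≤ memLoopCost d τ := memLoopCost_nonneg τ
  have hΔ : memLoopCost d τ ≤ U / Lc - 1 := by
    unfold memLoopCost
    have hq : 0 < memGrowth d (τ - 2) / memGrowth d τ := div_pos hμp hμc
    have h1 := Real.log_le_sub_one_of_pos hq
    have h2 : memGrowth d (τ - 2) / memGrowth d τ ≤ U / Lc := div_le_div₀ (hμp.le.trans hU) hU hLcpos hLc
    linarith
  have hf : memLoopDensity d τ = C / memGrowth d (τ - 2) ^ τ := by unfold memLoopDensity; rw [hC]
  have hfpos : 0 < memLoopDensity d τ := by rw [hf]; positivity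
  unfold loopCompat
  rw [div_le_iff₀ hfpos, hf]
  have hpow : memGrowth d (τ - 2) ^ τ ≤ U ^ τ := pow_le_pow_left₀ hμp.le hU τ
  have hμpow : 0 < memGrowth d (τ - 2) ^ τ := pow_pos hμp τ
  have halg : (U / Lc - 1) * U ^ τ / C * (C / memGrowth d (τ - 2) ^ τ)
      = (U / Lc - 1) * (U ^ τ / memGrowth d (τ - 2) ^ τ) := by
    field_simp
  rw [halg]
  have hratio : 1 ≤ U ^ τ / memGrowth d (τ - 2) ^ τ := by rw [le_div_iff₀ hμpow]; linarith
  have hnn : 0 ≤ U / Lc - 1 := le_trans hΔ0 hΔ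
  nlinarith [mul_le_mul_of_nonneg_left hratio hnn]

/-- **Lower bound of `R_τ` from brackets**: `0 < L ≤ μ_{τ−2}`, `μ_τ ≤ U'`, `2τ p_τ = C > 0` give
`(1 − U'/L)·L^τ/C ≤ R_τ(d)` (`log q ≥ 1 − 1/q`; trivial when the left side is `≤ 0`). [folklore] -/
theorem loopCompat_ge_of_brackets [NeZero d] {τ : ℕ} {Lp Uc C : ℝ} (hLp : Lp ≤ memGrowth d (τ - 2)) (hLppos : 0 < Lp)
    (hUc : memGrowth d τ ≤ Uc) (hC : (closingCount d τ : ℝ) = C) (hCpos : 0 < C) :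
    (1 - Uc / Lp) * Lp ^ τ / C ≤ loopCompat d τ := by
  have hμp : 0 < memGrowth d (τ - 2) := memGrowth_pos _
  have hμc : 0 < memGrowth d τ := memGrowth_pos _
  have hR0 : 0 ≤ loopCompat d τ := loopCompat_nonneg τ
  have hLpow : 0 ≤ Lp ^ τ := pow_nonneg hLppos.le τ
  by_cases hs : 1 - Uc / Lp ≤ 0
  · have h1 : (1 - Uc / Lp) * Lp ^ τ ≤ 0 * C := by nlinarith
    have := (div_le_iff₀ hCpos).2 h1
    linarith
  · push Not at hs
    have hΔ : 1 - Uc / Lp ≤ memLoopCost d τ := by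
      unfold memLoopCost
      have hq : 0 < memGrowth d (τ - 2) / memGrowth d τ := div_pos hμp hμc
      have h1 := Real.one_sub_inv_le_log_of_pos hq
      rw [inv_div] at h1
      have h2 : memGrowth d τ / memGrowth d (τ - 2) ≤ Uc / Lp := div_le_div₀ (hμc.le.trans hUc) hUc hLppos hLp
      linarith
    have hf : memLoopDensity d τ = C / memGrowth d (τ - 2) ^ τ := by unfold memLoopDensity; rw [hC]
    have hμpow : 0 < memGrowth d (τ - 2) ^ τ := pow_pos hμp τ
    have hfpos : 0 < memLoopDensity d τ := by rw [hf]; positivity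
    unfold loopCompat
    rw [le_div_iff₀ hfpos, hf]
    have hpow : Lp ^ τ ≤ memGrowth d (τ - 2) ^ τ := pow_le_pow_left₀ hLppos.le hLp τ
    have halg : (1 - Uc / Lp) * Lp ^ τ / C * (C / memGrowth d (τ - 2) ^ τ)
        = (1 - Uc / Lp) * (Lp ^ τ / memGrowth d (τ - 2) ^ τ) := by
      field_simp
    rw [halg]
    have hratio : Lp ^ τ / memGrowth d (τ - 2) ^ τ ≤ 1 := by rw [div_le_iff₀ hμpow]; linarith
    have hΔ0 : 0 ≤ memLoopCost d τ := memLoopCost_nonneg τ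
    nlinarith [mul_le_mul_of_nonneg_left hratio hs.le, div_nonneg hLpow hμpow.le]

/-- The upper bracket bound as ONE fraction: `((A/Da)/(B/Db) − 1)·(A/Da)^τ/C = (A·Db − B·Da)·A^τ/(B·Da^(τ+1)·C)`. [folklore] -/
theorem rup_identity {A Da B Db C : ℝ} (hDa : Da ≠ 0) (hB : B ≠ 0) (hC : C ≠ 0) (τ : ℕ) :
    ((A / Da) / (B / Db) - 1) * (A / Da) ^ τ / C = ((A * Db - B * Da) * A ^ τ) / (B * Da ^ (τ + 1) * C) := by
  have hDaτ : Da ^ τ ≠ 0 := pow_ne_zero _ hDa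
  rw [div_pow, pow_succ]
  field_simp

/-- The lower bracket bound as ONE fraction: `(1 − (B/Db)/(A/Da))·(A/Da)^(m+1)/C = (A·Db − B·Da)·A^m/(Db·Da^(m+1)·C)`. [folklore] -/
theorem rlo_identity {A Da B Db C : ℝ} (hDa : Da ≠ 0) (hDb : Db ≠ 0) (hA : A ≠ 0) (hC : C ≠ 0) (m : ℕ) :
    (1 - (B / Db) / (A / Da)) * (A / Da) ^ (m + 1) / C = ((A * Db - B * Da) * A ^ m) / (Db * Da ^ (m + 1) * C) := by
  have hDam : Da ^ m ≠ 0 := pow_ne_zero _ hDa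
  have hAm : A ^ m ≠ 0 := pow_ne_zero _ hA
  rw [div_pow, pow_succ, pow_succ]
  field_simp

/-! ### The brackets as integer polynomials in `d` -/

/-- `(2d)^7` as a coefficient list. [folklore] -/
def D7L : List ℤ := [0, 0, 0, 0, 0, 0, 0, 128]
/-- `(2d−1)^5`. [folklore] -/
def Da4loL : List ℤ := [-1, 10, -40, 80, -80, 32]
/-- `(2d−1)^6`. [folklore] -/
def Da4hiL : List ℤ := [1, -12, 60, -160, 240, -192, 64]
/-- Numerator of the lower seven-term bracket of `μ_4` (`P₆(2d−1)`). [folklore] -/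
def A4loL : List ℤ := [-33, 36, 0, -112, 224, -192, 64]
/-- Numerator of the upper seven-term bracket of `μ_4` (`P₇(2d−1)`). [folklore] -/
def A4hiL : List ℤ := [85, -102, 72, 112, -448, 640, -448, 128]
/-- Numerator of the upper uniform bound of `μ_6` (`num6Hi` as a list). [folklore] -/
def n6hiL : List ℤ := [743, 408, 32, 24, 176, -96, -64, -128, 256]
/-- Numerator of the lower uniform bound of `μ_6` (`num6Lo` as a list). [folklore] -/
def n6loL : List ℤ := [-1305, 408, 32, 24, 176, -96, -64, -128, 256]
/-- `2·6·p_6(ℤ^d) = 32d³ − 84d² + 52d`. [folklore] -/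
def cc6L : List ℤ := [0, 52, -84, 32]
/-- `2·8·p_8(ℤ^d) = 432d⁴ − 2096d³ + 3320d² − 1656d`. [folklore] -/
def cc8L : List ℤ := [0, -1656, 3320, -2096, 432]

/-- `peval D7L d = (2d)^7`. [folklore] -/
theorem peval_D7L (x : ℝ) : peval D7L x = (2 * x) ^ 7 := by simp [D7L, peval]; ring

/-- `μ_4(d) ≥ A4lo(d)/(2d−1)^5` (`d ≥ 4`). [folklore] -/
theorem mu4_ge_peval (hd : 4 ≤ d) : peval A4loL d / peval Da4loL d ≤ memGrowth d 4 := by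
  have hd' : (4 : ℝ) ≤ d := by exact_mod_cast hd
  have hx : (2 * (d : ℝ) - 1) ≠ 0 := by linarith
  have h := memGrowth_four_ge_series7 hd (x := 2 * (d : ℝ) - 1) rfl
  have hDa : peval Da4loL (d : ℝ) = (2 * (d : ℝ) - 1) ^ 5 := by simp [Da4loL, peval]; ring
  have hA : peval A4loL (d : ℝ) = -33 + 36 * (d : ℝ) - 112 * (d : ℝ) ^ 3 + 224 * (d : ℝ) ^ 4 - 192 * (d : ℝ) ^ 5 + 64 * (d : ℝ) ^ 6 := by simp [A4loL, peval]; ring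
  rw [hDa, hA]
  have e : ((2 * (d : ℝ) - 1) - 1 / (2 * (d : ℝ) - 1) + 2 / (2 * (d : ℝ) - 1) ^ 2 - 3 / (2 * (d : ℝ) - 1) ^ 3 + 8 / (2 * (d : ℝ) - 1) ^ 4 - 20 / (2 * (d : ℝ) - 1) ^ 5) = (-33 + 36 * (d : ℝ) - 112 * (d : ℝ) ^ 3 + 224 * (d : ℝ) ^ 4 - 192 * (d : ℝ) ^ 5 + 64 * (d : ℝ) ^ 6) / (2 * (d : ℝ) - 1) ^ 5 := by
    field_simp; ring
  rwa [e] at h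

/-- `μ_4(d) ≤ A4hi(d)/(2d−1)^6` (`d ≥ 4`). [folklore] -/
theorem mu4_le_peval (hd : 4 ≤ d) : memGrowth d 4 ≤ peval A4hiL d / peval Da4hiL d := by
  have hd' : (4 : ℝ) ≤ d := by exact_mod_cast hd
  have hx : (2 * (d : ℝ) - 1) ≠ 0 := by linarith
  have h := memGrowth_four_le_series7 hd (x := 2 * (d : ℝ) - 1) rfl
  have hDa : peval Da4hiL (d : ℝ) = (2 * (d : ℝ) - 1) ^ 6 := by simp [Da4hiL, peval]; ring
  have hA : peval A4hiL (d : ℝ) = 85 - 102 * (d : ℝ) + 72 * (d : ℝ) ^ 2 + 112 * (d : ℝ) ^ 3 - 448 * (d : ℝ) ^ 4 + 640 * (d : ℝ) ^ 5 - 448 * (d : ℝ) ^ 6 + 128 * (d : ℝ) ^ 7 := by simp [A4hiL, peval]; ring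
  rw [hDa, hA]
  have e : ((2 * (d : ℝ) - 1) - 1 / (2 * (d : ℝ) - 1) + 2 / (2 * (d : ℝ) - 1) ^ 2 - 3 / (2 * (d : ℝ) - 1) ^ 3 + 8 / (2 * (d : ℝ) - 1) ^ 4 - 20 / (2 * (d : ℝ) - 1) ^ 5 + 52 / (2 * (d : ℝ) - 1) ^ 6) = (85 - 102 * (d : ℝ) + 72 * (d : ℝ) ^ 2 + 112 * (d : ℝ) ^ 3 - 448 * (d : ℝ) ^ 4 + 640 * (d : ℝ) ^ 5 - 448 * (d : ℝ) ^ 6 + 128 * (d : ℝ) ^ 7) / (2 * (d : ℝ) - 1) ^ 6 := by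
    field_simp; ring
  rwa [e] at h

/-- `μ_6(d) ≥ n6lo(d)/(2d)^7` (`d ≥ 4`). [folklore] -/
theorem mu6_ge_peval (hd : 4 ≤ d) : peval n6loL d / peval D7L d ≤ memGrowth d 6 := by
  have h := memGrowth_six_ge_uniform hd
  have e1 : peval n6loL d = num6Lo d := by simp only [n6loL, num6Lo, peval]; push_cast; ring
  rwa [e1, peval_D7L]

/-- `μ_6(d) ≤ n6hi(d)/(2d)^7` (`d ≥ 4`). [folklore] -/
theorem mu6_le_peval (hd : 4 ≤ d) : memGrowth d 6 ≤ peval n6hiL d / peval D7L d := by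
  have h := memGrowth_six_le_uniform hd
  have e1 : peval n6hiL d = num6Hi d := by simp only [n6hiL, num6Hi, peval]; push_cast; ring
  rwa [e1, peval_D7L]

/-- `μ_8(d)` two-sided in `peval` form (`d ≥ 5`). [folklore] -/
theorem mu8_bounds_peval (hd : 5 ≤ d) :
    peval num8Lo d / peval D7L d ≤ memGrowth d 8 ∧ memGrowth d 8 ≤ peval num8Hi d / peval D7L d := by
  haveI : NeZero d := ⟨by omega⟩
  have hx : (5 : ℝ) ≤ d := by exact_mod_cast hd
  have h := memGrowth_bounds_of_upolycert5 (d := d) (by norm_num) hd ustruct_d5t8 usupp_d5t8 (c := 5)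
    (by exact_mod_cast hx) upolycert8 (num8Lo_pos hx)
  rwa [peval_D7L]

/-- `2·6·p_6(ℤ^d)` in `peval` form (`d ≥ 4`). [folklore] -/
theorem cc6_peval (hd : 4 ≤ d) : (closingCount d 6 : ℝ) = peval cc6L d := by
  rw [closingCount_six_eq_real hd]; simp [cc6L, peval]; ring

/-- `2·8·p_8(ℤ^d)` in `peval` form (`d ≥ 5`). [folklore] -/
theorem cc8_peval (hd : 5 ≤ d) : (closingCount d 8 : ℝ) = peval cc8L d := by
  rw [closingCount_eight_eq_real hd]; simp [cc8L, peval]; ring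

/-! ### `R_6` and `R_8` between ratios of integer polynomials -/

/-- Numerator of the upper bound of `R_8`. [folklore] -/
def NU8 : List ℤ := pmul (psub (pmul n6hiL D7L) (pmul num8Lo D7L)) (ppow n6hiL 8)
/-- Denominator of the upper bound of `R_8`. [folklore] -/
def DE8 : List ℤ := pmul (pmul num8Lo (ppow D7L 9)) cc8L
/-- Numerator of the lower bound of `R_8`. [folklore] -/
def NL8 : List ℤ := pmul (psub (pmul n6loL D7L) (pmul num8Hi D7L)) (ppow n6loL 7)
/-- Denominator of the lower bound of `R_8`. [folklore] -/
def DL8 : List ℤ := pmul (pmul D7L (ppow D7L 8)) cc8L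
/-- Numerator of the lower bound of `R_6`. [folklore] -/
def NL6 : List ℤ := pmul (psub (pmul A4loL D7L) (pmul n6hiL Da4loL)) (ppow A4loL 5)
/-- Denominator of the lower bound of `R_6`. [folklore] -/
def DL6 : List ℤ := pmul (pmul D7L (ppow Da4loL 6)) cc6L

/-- Positivity of the `R_8` upper denominator for `d ≥ 5`. [folklore] -/
theorem DE8_pos (hd : 5 ≤ d) : 0 < peval DE8 d :=
  peval_pos_of_shift (c := 5) (by decide +kernel) (by exact_mod_cast hd)
/-- Positivity of the `R_8` lower denominator for `d ≥ 5`. [folklore] -/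
theorem DL8_pos (hd : 5 ≤ d) : 0 < peval DL8 d :=
  peval_pos_of_shift (c := 5) (by decide +kernel) (by exact_mod_cast hd)
/-- Positivity of the `R_6` lower denominator for `d ≥ 4`. [folklore] -/
theorem DL6_pos (hd : 4 ≤ d) : 0 < peval DL6 d :=
  peval_pos_of_shift (c := 4) (by decide +kernel) (by exact_mod_cast hd)

/-- **`R_8(d) ≤ NU8(d)/DE8(d)`** for every `d ≥ 5`. [folklore] -/
theorem loopCompat_eight_le_peval (hd : 5 ≤ d) : loopCompat d 8 ≤ peval NU8 d / peval DE8 d := by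
  haveI : NeZero d := ⟨by omega⟩
  have hd' : (5 : ℝ) ≤ d := by exact_mod_cast hd
  have hD7 : 0 < peval D7L d := by rw [peval_D7L]; positivity
  have hB : 0 < peval num8Lo d := num8Lo_pos hd'
  have hC : 0 < peval cc8L d := by rw [← cc8_peval hd]; exact_mod_cast closingCount_even_pos (d := d) (by omega) (m := 4) (by norm_num)
  have h := loopCompat_le_of_brackets (τ := 8) (mu6_le_peval (by omega)) (mu8_bounds_peval hd).1 (div_pos hB hD7)
    (cc8_peval hd) hC
  rw [rup_identity hD7.ne' hB.ne' hC.ne'] at h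
  simpa only [NU8, DE8, peval_pmul, peval_psub, peval_ppow] using h

/-- **`NL8(d)/DL8(d) ≤ R_8(d)`** for every `d ≥ 5`. [folklore] -/
theorem loopCompat_eight_ge_peval (hd : 5 ≤ d) : peval NL8 d / peval DL8 d ≤ loopCompat d 8 := by
  haveI : NeZero d := ⟨by omega⟩
  have hd' : (5 : ℝ) ≤ d := by exact_mod_cast hd
  have hD7 : 0 < peval D7L d := by rw [peval_D7L]; positivity
  have hA : 0 < peval n6loL d :=
    peval_pos_of_shift (p := n6loL) (c := 4) (by decide +kernel) (by exact_mod_cast (show 4 ≤ d by omega))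
  have hC : 0 < peval cc8L d := by rw [← cc8_peval hd]; exact_mod_cast closingCount_even_pos (d := d) (by omega) (m := 4) (by norm_num)
  have h := loopCompat_ge_of_brackets (τ := 8) (mu6_ge_peval (by omega)) (div_pos hA hD7) (mu8_bounds_peval hd).2
    (cc8_peval hd) hC
  rw [show (8 : ℕ) = 7 + 1 from rfl, rlo_identity hD7.ne' hD7.ne' hA.ne' hC.ne'] at h
  simpa only [NL8, DL8, peval_pmul, peval_psub, peval_ppow] using h

/-- **`NL6(d)/DL6(d) ≤ R_6(d)`** for every `d ≥ 4`. [folklore] -/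
theorem loopCompat_six_ge_peval (hd : 4 ≤ d) : peval NL6 d / peval DL6 d ≤ loopCompat d 6 := by
  haveI : NeZero d := ⟨by omega⟩
  have hd' : (4 : ℝ) ≤ d := by exact_mod_cast hd
  have hD7 : 0 < peval D7L d := by rw [peval_D7L]; positivity
  have hDa : 0 < peval Da4loL d := peval_pos_of_shift (c := 4) (by decide +kernel) (by exact_mod_cast hd')
  have hA : 0 < peval A4loL d := peval_pos_of_shift (c := 4) (by decide +kernel) (by exact_mod_cast hd')
  have hC : 0 < peval cc6L d := by rw [← cc6_peval hd]; exact_mod_cast closingCount_even_pos (d := d) (by omega) (m := 3) (by norm_num)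
  have h := loopCompat_ge_of_brackets (τ := 6) (mu4_ge_peval hd) (div_pos hA hDa) (mu6_le_peval hd) (cc6_peval hd) hC
  rw [show (6 : ℕ) = 5 + 1 from rfl, rlo_identity hDa.ne' hD7.ne' hA.ne' hC.ne'] at h
  simpa only [NL6, DL6, peval_pmul, peval_psub, peval_ppow] using h

end Summit.CriticalPhenomena.PercolationContinuityZ3.Theorems.Pcint.MemoryTail
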